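/- WIDTH seat `ym-line-cbag-p1-w3` (prover-ym-line-cbag-p1-w3-g16-0), LINE 7 `GlueballBandRecursion`, in support of ⟨stmt-QuantumFields-22957⟩
`OneParticleBlochSymbolFamily` (= `Band.EffectiveBlochSymbolFamily`): an S1-side prefab — COVARIANT LÖWDIN ORTHONORMALISATION.  The
Bloch reduction of the band (LEAD's `transfer_bloch_reduction`, w4's `…BlochCovariantFamily`) consumes a translation-covariant
ORTHONORMAL frame; a cluster expansion / spectral projection delivers translation-covariant but merely LINEARLY INDEPENDENT dressed
excitations.  This file closes that gap once and for all (symmetric orthonormalisation preserves covariance).  Route-independent;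
definition-free; a helper. -/
import Summits.QuantumFields.YangMills.Theorems.GlueballBandRecursionBlochTransfer
import Mathlib.Analysis.InnerProductSpace.GramMatrix
import Mathlib.Analysis.Matrix.Order
import Mathlib.Analysis.SpecialFunctions.ContinuousFunctionalCalculus.Rpow.Basic

/-!
# Route `GlueballBandRecursion`, item `OneParticleBlochSymbolFamily` (stmt-QuantumFields-22957): covariant Löwdin orthonormalisation —
# a translation-covariant linearly independent family has a translation-covariant orthonormal frame with the same span

Setting: a real inner-product space `E`, a finite additive group `X` acting on `E` by linear isometries `U_a` (the Koopman translations
of the torus `(ℤ/N)³` on `L²(G^{E₃})`), a finite label type `J`, and a family `φ : X × J → E` which is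
* translation-COVARIANT, `φ (a + x, j) = U_a (φ (x, j))`, and
* LINEARLY INDEPENDENT
(the dressed one-plaquette excitations of the strong-coupling transfer matrix and their translates, as stub S1 of the planner's plan —
the cluster expansion — produces them; or `P φ⁰_{x,j}` for a translation-invariant spectral projection `P` and bare local excitations `φ⁰`).

* `exists_orthonormal_covariant_of_linearIndependent`: there is an ORTHONORMAL family `ψ : X × J → E`, again covariant
  `ψ (a + x, j) = U_a (ψ (x, j))`, with `ψ_i ∈ span φ` and `φ_i ∈ span ψ` (same span).  Construction (Löwdin 1950): `ψ = φ·S⁻¹` with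
  `S = √G`, `G = gram ℝ φ` the Gram matrix (positive definite by Mathlib's `posDef_gram_of_linearIndependent`, square root by the continuous
  functional calculus `CFC.sqrt`); orthonormality is `S⁻¹ G S⁻¹ = 1`; covariance: `G` is invariant under the re-indexing `(x, j) ↦ (a + x, j)`
  (the `U_a` are isometries), hence so is `√G` by UNIQUENESS of the non-negative square root (`CFC.sqrt_eq_iff`), hence so is `S⁻¹`.
* `exists_orthonormal_covariant_frame`: the transfer-matrix instance — for `φ : (ℤ/N)³ × Fin n → L²(G^{E₃})` covariant under
  `koopmanTranslate` and linearly independent, spanning a `𝕋`-invariant subspace (`𝕋 = wilsonTorusTransferMatrix r.ρ β N`), an orthonormal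
  covariant frame `ψ` of the SAME subspace, i.e. exactly the hypotheses `hψ`, `hcov`, `hinv` of `transfer_bloch_reduction` /
  `sum_re_trace_transferBloch_pow_le_traceExcess` / `…BandUpperGap` — so stub S1 only owes a covariant linearly independent spanning family
  of the isolated band (plus isolation and kernel bounds), not an orthonormal one.

Sources: P.-O. Löwdin, J. Chem. Phys. 18 (1950) 365 (symmetric orthonormalisation); folklore.  HONEST FRAMING.  Finite-dimensional linear
algebra; item ⟨stmt-QuantumFields-22957⟩, the rung `ColdDoublingRecursionStrongCoupling` and the Yang–Mills mass gap / the summit `YangMills`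
are NOT proved or advanced here.
-/

set_option autoImplicit false

noncomputable section

open scoped InnerProductSpace BigOperators MatrixOrder
open MeasureTheory Matrix

namespace Summit.QuantumFields.YangMills.Theorems.GlueballBandRecursion.Band

/-! ### §1 Abstract covariant Löwdin orthonormalisation -/

section Abstract

variable {E : Type*} [NormedAddCommGroup E] [InnerProductSpace ℝ E]
variable {ι : Type*} [Fintype ι] [DecidableEq ι]

/-- The Löwdin square root `S = √(gram φ)` of a finite family: `S·S = gram φ`, `Sᵀ = S`. [folklore] -/
theorem sqrt_gram_mul_self_and_transpose (φ : ι → E) :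
    CFC.sqrt (gram ℝ φ) * CFC.sqrt (gram ℝ φ) = gram ℝ φ ∧ (CFC.sqrt (gram ℝ φ))ᵀ = CFC.sqrt (gram ℝ φ) := by
  have hG0 : 0 ≤ gram ℝ φ := (posSemidef_gram ℝ φ).nonneg
  refine ⟨CFC.sqrt_mul_sqrt_self _ hG0, ?_⟩
  have h : (CFC.sqrt (gram ℝ φ)).IsHermitian := (CFC.sqrt_nonneg (gram ℝ φ)).posSemidef.1
  rw [IsHermitian, conjTranspose_eq_transpose_of_trivial] at h
  exact h

/-- For a linearly independent family the Löwdin square root `√(gram φ)` is invertible. [folklore] -/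
theorem isUnit_det_sqrt_gram {φ : ι → E} (hφ : LinearIndependent ℝ φ) : IsUnit (CFC.sqrt (gram ℝ φ)).det :=
  (isUnit_iff_isUnit_det _).1
    ((CFC.isUnit_sqrt_iff _ (posSemidef_gram ℝ φ).nonneg).2 (posDef_gram_of_linearIndependent hφ).isUnit)

/-- **Symmetry of the Löwdin square root**: if the Gram matrix is invariant under a re-indexing `σ` of the family
(`(gram φ).submatrix σ σ = gram φ`), so are `√(gram φ)` and its inverse — by uniqueness of the non-negative square root. [folklore] -/
theorem sqrt_gram_submatrix_eq (φ : ι → E) (σ : ι ≃ ι) (hσ : (gram ℝ φ).submatrix σ σ = gram ℝ φ) :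
    (CFC.sqrt (gram ℝ φ)).submatrix σ σ = CFC.sqrt (gram ℝ φ) ∧
      (CFC.sqrt (gram ℝ φ))⁻¹.submatrix σ σ = (CFC.sqrt (gram ℝ φ))⁻¹ := by
  have hG0 : 0 ≤ gram ℝ φ := (posSemidef_gram ℝ φ).nonneg
  have hS0 : 0 ≤ CFC.sqrt (gram ℝ φ) := CFC.sqrt_nonneg _
  have hS'0 : 0 ≤ (CFC.sqrt (gram ℝ φ)).submatrix σ σ := (hS0.posSemidef.submatrix σ).nonneg
  have h1 : (CFC.sqrt (gram ℝ φ)).submatrix σ σ = CFC.sqrt (gram ℝ φ) := by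
    symm
    refine (CFC.sqrt_eq_iff (gram ℝ φ) _ hG0 hS'0).2 ?_
    rw [submatrix_mul_equiv, CFC.sqrt_mul_sqrt_self _ hG0, hσ]
  exact ⟨h1, by rw [← inv_submatrix_equiv, h1]⟩

/-- **Covariant Löwdin orthonormalisation.**  A finite additive group `X` acting by linear isometries `U_a` on a real inner-product space,
a finite label type `J`, and a LINEARLY INDEPENDENT, translation-COVARIANT family `φ (a + x, j) = U_a (φ (x, j))`: then there is an
ORTHONORMAL family `ψ : X × J → E`, covariant `ψ (a + x, j) = U_a (ψ (x, j))`, with the same span (`ψ_i ∈ span φ`, `φ_i ∈ span ψ`).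
(`ψ_c = Σ_b (√G)⁻¹_{bc} φ_b`, `G` the Gram matrix; Löwdin's symmetric orthonormalisation, J. Chem. Phys. 18 (1950) 365.) [folklore] -/
theorem exists_orthonormal_covariant_of_linearIndependent {X : Type*} [AddCommGroup X] [Fintype X] [DecidableEq X]
    {J : Type*} [Fintype J] [DecidableEq J] (U : X → E →ₗᵢ[ℝ] E) (φ : X × J → E) (hφ : LinearIndependent ℝ φ)
    (hcov : ∀ (a x : X) (j : J), φ (a + x, j) = U a (φ (x, j))) :
    ∃ ψ : X × J → E, Orthonormal ℝ ψ ∧ (∀ (a x : X) (j : J), ψ (a + x, j) = U a (ψ (x, j))) ∧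
      (∀ i, ψ i ∈ Submodule.span ℝ (Set.range φ)) ∧ (∀ i, φ i ∈ Submodule.span ℝ (Set.range ψ)) := by
  obtain ⟨hSS, hST⟩ := sqrt_gram_mul_self_and_transpose φ
  have hSdet := isUnit_det_sqrt_gram hφ
  set Gm : Matrix (X × J) (X × J) ℝ := gram ℝ φ with hGdef
  set S : Matrix (X × J) (X × J) ℝ := CFC.sqrt Gm with hSdef
  set R : Matrix (X × J) (X × J) ℝ := S⁻¹ with hRdef
  have hRS : R * S = 1 := nonsing_inv_mul S hSdet
  have hSR : S * R = 1 := mul_nonsing_inv S hSdet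
  have hRT : Rᵀ = R := by rw [hRdef, transpose_nonsing_inv, hST]
  have hRGR : R * Gm * R = 1 := by
    calc R * Gm * R = R * S * (S * R) := by rw [← hSS]; simp only [Matrix.mul_assoc]
      _ = 1 := by rw [hRS, hSR, Matrix.one_mul]
  -- translation invariance of the Gram matrix, of its square root and of `R`
  let σ : X → (X × J ≃ X × J) := fun a => Equiv.prodCongr (Equiv.addLeft a) (Equiv.refl J)
  have hσ : ∀ (a x : X) (j : J), σ a (x, j) = (a + x, j) := fun a x j => rfl
  have hGσ : ∀ a, Gm.submatrix (σ a) (σ a) = Gm := by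
    intro a
    ext ⟨x, j⟩ ⟨y, k⟩
    rw [submatrix_apply, hσ, hσ, hGdef, gram_apply, gram_apply, hcov, hcov, LinearIsometry.inner_map_map]
  have hRσ : ∀ a, R.submatrix (σ a) (σ a) = R := fun a => (sqrt_gram_submatrix_eq φ (σ a) (hGσ a)).2
  refine ⟨fun c => ∑ b, R b c • φ b, ?_, ?_, ?_, ?_⟩
  · -- orthonormality: `⟪ψ_a, ψ_c⟫ = (Rᵀ G R)_{ac} = δ_{ac}`
    rw [orthonormal_iff_ite]
    intro a c
    have key : ⟪∑ b, R b a • φ b, ∑ d, R d c • φ d⟫_ℝ = (Rᵀ * (Gm * R)) a c := by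
      rw [sum_inner, Matrix.mul_apply]
      refine Finset.sum_congr rfl fun b _ => ?_
      rw [real_inner_smul_left, inner_sum, transpose_apply, Matrix.mul_apply]
      simp only [Finset.mul_sum]
      refine Finset.sum_congr rfl fun d _ => ?_
      rw [real_inner_smul_right, hGdef, gram_apply]
      ring
    rw [key, hRT, ← Matrix.mul_assoc, hRGR, Matrix.one_apply]
  · -- covariance: `R` is translation invariant and `U_a` is linear
    intro a x j
    show ∑ b, R b (a + x, j) • φ b = U a (∑ b, R b (x, j) • φ b)
    rw [map_sum, ← Equiv.sum_comp (σ a) (fun b => R b (a + x, j) • φ b)]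
    refine Finset.sum_congr rfl fun b _ => ?_
    obtain ⟨y, k⟩ := b
    have h1 : R (σ a (y, k)) (a + x, j) = R (y, k) (x, j) := by
      have h := congr_fun (congr_fun (hRσ a) (y, k)) (x, j)
      rwa [submatrix_apply, hσ] at h
    rw [LinearIsometry.map_smul, h1, hσ, hcov]
  · intro c
    exact Submodule.sum_mem _ fun b _ => Submodule.smul_mem _ _ (Submodule.subset_span ⟨b, rfl⟩)
  · intro c
    -- `φ_c = Σ_b S_{bc} ψ_b` since `R S = 1`
    have hφc : φ c = ∑ b, S b c • ∑ d, R d b • φ d := by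
      simp_rw [Finset.smul_sum, smul_smul]
      rw [Finset.sum_comm]
      simp_rw [← Finset.sum_smul]
      have h : ∀ d, ∑ b, S b c * R d b = (R * S) d c := fun d => by
        rw [Matrix.mul_apply]
        exact Finset.sum_congr rfl fun b _ => mul_comm _ _
      simp_rw [h, hRS, Matrix.one_apply, ite_smul, one_smul, zero_smul, Finset.sum_ite_eq', Finset.mem_univ,
        if_true]
    rw [hφc]
    exact Submodule.sum_mem _ fun b _ => Submodule.smul_mem _ _
      (Submodule.subset_span ⟨b, rfl⟩)

end Abstract

/-! ### §2 The transfer matrix: covariant frames of an invariant subspace from covariant linearly independent families -/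

section Transfer

variable {G : Type} [Group G] [TopologicalSpace G] [IsTopologicalGroup G] [CompactSpace G]
  [MeasurableSpace G] [BorelSpace G]

open Literature.MathematicalPhysics.QuantumFieldTheory

/-- **Covariant orthonormal frame of the band from dressed excitations.**  For `φ : (ℤ/N)³ × Fin n → L²(G^{E₃})` linearly independent and
covariant under the Koopman translations (`φ (v + x, j) = koopmanTranslate N v (φ (x, j))`), spanning a subspace invariant under
`𝕋 = wilsonTorusTransferMatrix r.ρ β N`: there is an ORTHONORMAL covariant frame `ψ` of the SAME subspace, `𝕋`-invariant — exactly the data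
`hψ`, `hcov`, `hinv` of `transfer_bloch_reduction` (and of `…BandUpperGap`, `…BlochTransfer`). [folklore] -/
theorem exists_orthonormal_covariant_frame (r : LatticeRep G) (β : ℝ) (N : ℕ) [NeZero N] {n : ℕ}
    (φ : Site 3 N × Fin n → Lp ℝ 2 (Measure.pi fun _ : Edge 3 N => haarProbability G))
    (hφ : LinearIndependent ℝ φ)
    (hcov : ∀ (v x : Site 3 N) (j : Fin n), φ (v + x, j) = koopmanTranslate N v (φ (x, j)))
    (hinv : ∀ b, wilsonTorusTransferMatrix r.ρ β N (φ b) ∈ Submodule.span ℝ (Set.range φ)) :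
    ∃ ψ : Site 3 N × Fin n → Lp ℝ 2 (Measure.pi fun _ : Edge 3 N => haarProbability G),
      Orthonormal ℝ ψ ∧ (∀ (v x : Site 3 N) (j : Fin n), ψ (v + x, j) = koopmanTranslate N v (ψ (x, j))) ∧
      (∀ b, wilsonTorusTransferMatrix r.ρ β N (ψ b) ∈ Submodule.span ℝ (Set.range ψ)) ∧
      Submodule.span ℝ (Set.range ψ) = Submodule.span ℝ (Set.range φ) := by
  obtain ⟨ψ, hψ, hψcov, hψmem, hφmem⟩ := exists_orthonormal_covariant_of_linearIndependent
    (fun v : Site 3 N => Lp.compMeasurePreservingₗᵢ ℝ (configTranslate (G := G) v)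
      (measurePreserving_configTranslate v (haarProbability G))) φ hφ hcov
  have hspan : Submodule.span ℝ (Set.range ψ) = Submodule.span ℝ (Set.range φ) :=
    le_antisymm (Submodule.span_le.2 (Set.range_subset_iff.2 hψmem))
      (Submodule.span_le.2 (Set.range_subset_iff.2 hφmem))
  refine ⟨ψ, hψ, hψcov, fun b => ?_, hspan⟩
  rw [hspan]
  have hb : ψ b ∈ Submodule.span ℝ (Set.range φ) := hψmem b
  -- `𝕋` maps `span φ` into itself (linear map, generators)
  have hT : ∀ v ∈ Submodule.span ℝ (Set.range φ),
      wilsonTorusTransferMatrix r.ρ β N v ∈ Submodule.span ℝ (Set.range φ) := by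
    intro v hv
    refine Submodule.span_induction (p := fun v _ => wilsonTorusTransferMatrix r.ρ β N v ∈ Submodule.span ℝ (Set.range φ))
      ?_ ?_ ?_ ?_ hv
    · rintro _ ⟨b', rfl⟩
      exact hinv b'
    · rw [map_zero]
      exact Submodule.zero_mem _
    · intro u w _ _ hu hw
      rw [map_add]
      exact Submodule.add_mem _ hu hw
    · intro c u _ hu
      rw [map_smul]
      exact Submodule.smul_mem _ _ hu
  exact hT _ hb

end Transfer

end Summit.QuantumFields.YangMills.Theorems.GlueballBandRecursion.Band

end
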